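import Mathlib
import HarnessLib
import Literature.NumberTheory.LFunctions.HorocycleRateHalf
import Literature.NumberTheory.LFunctions.HorocycleStripFourier
import Literature.Analysis.FunctionSpaces.SmoothParametricIntegral

/-!
# Strip test functions (`IsStripFun`): derivatives, bounds and Fourier coefficients

Support file for the elementary proof of `Literature.NumberTheory.LFunctions.zagier_horocycle_rate_half`
(skeleton in `HorocycleRateHalf.lean`). It is the `IsStripFun`-flavoured API over the twin
file `HorocycleStripFourier.lean` (landed for the twin fact `zagier_sarnak_horocycle_rate_half`,
which carries smoothness, periodicity and strip support as explicit hypotheses): an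
`IsStripFun Y₁ g` (smooth on `ℍ`, `1`-periodic, zero for `im < 1/2` and for `im > Y₁`) is in
fact smooth on all of `ℂ` (`IsStripFun.contDiff`: smooth on the open set `im > 0`, locally zero
on the open set `im < 1/2`) and supported in the strip `1/2 ≤ im ≤ Y₁` (`IsStripFun.supp`),
so the results of that file apply; here they are re-exported under the predicate
(boundedness, stability under `∂θ = D(·)(1)` and `∂h = D(·)(i)`, slice derivatives, the
Fourier coefficients `ĝ_k(h) = ∫₀¹ g(θ+ih) e(-kθ) dθ` (`sliceFourierCoeff`) with their vanishing, integration by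
parts, decay `O(|k|⁻³)`, derivative in `h` and the pointwise Fourier expansion of the slices),
together with what the twin lacks and the sibling files use (the skeleton's docstring calls them
`HorocycleArcTransform.lean` / `HorocycleUnfolding.lean`; they are proposed as
`HorocycleRateHalfArc.lean`, `HorocycleRateHalfArcBound.lean`, `HorocycleRateHalfUnfolding.lean`): vanishing at `im = 1/2` (`zero_of_im_le`), a summable
majorant of `ĝ_k(h)` uniform in `h` (`exists_summable_bound`), and `C^∞` dependence of
`ĝ_k(h)` on `h` (`contDiff_sliceFourierCoeff`, via `Literature.Analysis.FunctionSpaces.contDiff_parametric_intervalIntegral`).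
Everything here is PROVED.

## References
* H. Iwaniec, *Spectral Methods of Automorphic Forms*, 2nd ed., AMS GSM 53 (2002), §3.2–§3.4
  [Iwaniec2002].
-/

noncomputable section

open Real Complex MeasureTheory Set Filter Asymptotics intervalIntegral
open scoped Topology ContDiff

namespace Literature.NumberTheory.LFunctions

variable {Y₁ : ℝ} {g : ℂ → ℂ}

/-! ### Basic properties of the class `IsStripFun` -/

namespace IsStripFun

/-- **Bridge to `HorocycleStripFourier`**: a strip test function is smooth on all of `ℂ`
(smooth on the open set `im > 0`, identically zero on the open set `im < 1/2`). [folklore] -/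
theorem contDiff (hg : IsStripFun Y₁ g) : ContDiff ℝ ∞ g :=
  contDiff_iff_contDiffAt.mpr fun z => by
    rcases lt_or_ge 0 z.im with hz | hz
    · exact (hg.smooth z hz).contDiffAt (UpperHalfPlane.isOpen_upperHalfPlaneSet.mem_nhds hz)
    · refine (contDiffAt_const (c := (0 : ℂ))).congr_of_eventuallyEq ?_
      filter_upwards [(isOpen_lt Complex.continuous_im continuous_const).mem_nhds
        (show z.im < 1 / 2 by linarith)] with w hw
      exact hg.zero_of_im_lt w hw

/-- Continuity on `ℍ`. [folklore] -/
theorem continuousOn (hg : IsStripFun Y₁ g) : ContinuousOn g {z : ℂ | 0 < z.im} :=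
  hg.contDiff.continuous.continuousOn

/-- Integer periodicity `g (z + n) = g z`, `n ∈ ℤ`. [folklore] -/
theorem periodic_int (hg : IsStripFun Y₁ g) (z : ℂ) (n : ℤ) : g (z + n) = g z :=
  HorocycleStripFourier.periodic_int hg.periodic z n

/-- Vanishing for `im z ≤ 1/2` (at `im z = 1/2` by continuity from below). [folklore] -/
theorem zero_of_im_le (hg : IsStripFun Y₁ g) {z : ℂ} (hz : z.im ≤ 1 / 2) : g z = 0 := by
  rcases hz.lt_or_eq with h | h
  · exact hg.zero_of_im_lt z h
  · -- `z` is the limit of `z - s i`, `s → 0⁺`, where `g = 0`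
    have hcont : ContinuousAt g z := hg.contDiff.continuous.continuousAt
    have hlim : Tendsto (fun s : ℝ => g (z - (s : ℂ) * I)) (𝓝[>] 0) (𝓝 (g z)) := by
      have h1 : Tendsto (fun s : ℝ => z - (s : ℂ) * I) (𝓝[>] 0) (𝓝 z) := by
        have : Continuous fun s : ℝ => z - (s : ℂ) * I := by fun_prop
        have h2 := this.tendsto 0
        simp only [Complex.ofReal_zero, zero_mul, sub_zero] at h2
        exact h2.mono_left nhdsWithin_le_nhds
      exact hcont.tendsto.comp h1
    have hzero : ∀ᶠ s : ℝ in 𝓝[>] 0, g (z - (s : ℂ) * I) = 0 := by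
      filter_upwards [self_mem_nhdsWithin] with s hs
      apply hg.zero_of_im_lt
      simp only [Complex.sub_im, Complex.mul_im, Complex.ofReal_re, Complex.I_im, mul_one,
        Complex.ofReal_im, Complex.I_re, mul_zero, add_zero]
      rw [h]; simp only [Set.mem_Ioi] at hs; linarith
    have hlim0 : Tendsto (fun s : ℝ => g (z - (s : ℂ) * I)) (𝓝[>] 0) (𝓝 0) :=
      (tendsto_congr' hzero).mpr tendsto_const_nhds
    exact tendsto_nhds_unique hlim hlim0

/-- The support lies in `1/2 < im z ≤ Y₁`. [folklore] -/
theorem im_mem_of_ne_zero (hg : IsStripFun Y₁ g) {z : ℂ} (hz : g z ≠ 0) : 1 / 2 < z.im ∧ z.im ≤ Y₁ := by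
  by_contra h
  rw [not_and_or, not_lt, not_le] at h
  rcases h with h | h
  · exact hz (hg.zero_of_im_le h)
  · exact hz (hg.zero_of_lt_im z h)

/-- **Bridge to `HorocycleStripFourier`**: the strip-support hypothesis of that file, with
`a = 1/2`, `b = Y₁`. [folklore] -/
theorem supp (hg : IsStripFun Y₁ g) : ∀ z : ℂ, g z ≠ 0 → 1 / 2 ≤ z.im ∧ z.im ≤ Y₁ :=
  fun _ hz => ⟨(hg.im_mem_of_ne_zero hz).1.le, (hg.im_mem_of_ne_zero hz).2⟩

/-- **Boundedness** (`HorocycleStripFourier.exists_bound`). [folklore] -/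
theorem exists_bound (hg : IsStripFun Y₁ g) : ∃ B : ℝ, 0 ≤ B ∧ ∀ z : ℂ, ‖g z‖ ≤ B :=
  HorocycleStripFourier.exists_bound hg.contDiff.continuous hg.periodic hg.supp

end IsStripFun

/-! ### Partial derivatives -/

/-- `∂θ g = D g (1)`, the derivative along the horocycle direction. [folklore] -/
def derivTheta (g : ℂ → ℂ) (z : ℂ) : ℂ := fderiv ℝ g z 1

/-- `∂h g = D g (i)`, the derivative in the height. [folklore] -/
def derivH (g : ℂ → ℂ) (z : ℂ) : ℂ := fderiv ℝ g z I

namespace IsStripFun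

/-- A directional derivative of a strip test function is a strip test function
(`HorocycleStripFourier.contDiff_fderiv_apply` / `periodic_fderiv_apply` /
`support_fderiv_apply`). [folklore] -/
theorem fderiv_apply (hg : IsStripFun Y₁ g) (v : ℂ) : IsStripFun Y₁ (fun z => fderiv ℝ g z v) where
  smooth := (HorocycleStripFourier.contDiff_fderiv_apply hg.contDiff v).contDiffOn
  periodic := HorocycleStripFourier.periodic_fderiv_apply hg.periodic v
  zero_of_im_lt := fun z hz => by
    by_contra h
    exact absurd (HorocycleStripFourier.support_fderiv_apply hg.supp v z h).1 (not_le.mpr hz)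
  zero_of_lt_im := fun z hz => by
    by_contra h
    exact absurd (HorocycleStripFourier.support_fderiv_apply hg.supp v z h).2 (not_le.mpr hz)

/-- `∂θ g` is a strip test function. [folklore] -/
theorem dTheta (hg : IsStripFun Y₁ g) : IsStripFun Y₁ (derivTheta g) := hg.fderiv_apply 1

/-- `∂h g` is a strip test function. [folklore] -/
theorem dH (hg : IsStripFun Y₁ g) : IsStripFun Y₁ (derivH g) := hg.fderiv_apply I

/-- The horizontal slice `θ ↦ g(θ + ih)` has derivative `∂θ g`
(`HorocycleStripFourier.hasDerivAt_horizontal`). [folklore] -/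
theorem hasDerivAt_slice (hg : IsStripFun Y₁ g) (h θ : ℝ) :
    HasDerivAt (fun θ : ℝ => g (θ + h * I)) (derivTheta g (θ + h * I)) θ :=
  HorocycleStripFourier.hasDerivAt_horizontal hg.contDiff h θ

/-- The vertical slice `h ↦ g(θ + ih)` has derivative `∂h g`
(`HorocycleStripFourier.hasDerivAt_vertical`). [folklore] -/
theorem hasDerivAt_vslice (hg : IsStripFun Y₁ g) (θ h : ℝ) :
    HasDerivAt (fun h : ℝ => g (θ + h * I)) (derivH g (θ + h * I)) h :=
  HorocycleStripFourier.hasDerivAt_vertical hg.contDiff θ h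

/-- The slices in the plane: `(θ, h) ↦ g(θ + ih)` is `C^∞` on `ℝ²`. [folklore] -/
theorem contDiff_plane (hg : IsStripFun Y₁ g) :
    ContDiff ℝ (⊤ : ℕ∞) (fun p : ℝ × ℝ => g ((p.1 : ℂ) + (p.2 : ℂ) * I)) :=
  hg.contDiff.comp ((Complex.ofRealCLM.contDiff.comp contDiff_fst).add
    ((Complex.ofRealCLM.contDiff.comp contDiff_snd).mul contDiff_const))

/-- The slice `θ ↦ g(θ + ih)` is continuous. [folklore] -/
theorem continuous_slice (hg : IsStripFun Y₁ g) (h : ℝ) : Continuous fun θ : ℝ => g (θ + h * I) :=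
  hg.contDiff_plane.continuous.comp (continuous_id.prodMk continuous_const)

end IsStripFun

/-! ### Fourier coefficients of the slices -/

/-- The Fourier coefficient `ĝ_k(h) = ∫₀¹ g(θ + ih) e(-kθ) dθ` of the slice of `g` at height `h`
(same integrand as in `HorocycleStripFourier.lean`; `= fourierCoeffOn zero_lt_one (slice) k`,
see `sliceFourierCoeff_eq_fourierCoeffOn`). [folklore] -/
def sliceFourierCoeff (g : ℂ → ℂ) (k : ℤ) (h : ℝ) : ℂ :=
  ∫ θ in (0 : ℝ)..1, g (θ + h * I) * Complex.exp (-(2 * π * I * k * θ))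

/-- `|e(-kθ)| = 1` (`HorocycleStripFourier.norm_exp_neg_two_pi_mul`). [folklore] -/
theorem norm_cexp_neg_two_pi (k : ℤ) (θ : ℝ) : ‖Complex.exp (-(2 * π * I * k * θ))‖ = 1 :=
  HorocycleStripFourier.norm_exp_neg_two_pi_mul k θ

/-- `θ ↦ e(-kθ)` is smooth. [folklore] -/
theorem contDiff_cexp_neg_two_pi (k : ℤ) :
    ContDiff ℝ (⊤ : ℕ∞) fun θ : ℝ => Complex.exp (-(2 * π * I * k * θ)) := by
  have h1 : ContDiff ℝ (⊤ : ℕ∞) fun θ : ℝ => -(2 * π * I * k * (θ : ℂ)) :=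
    (contDiff_const.mul Complex.ofRealCLM.contDiff).neg
  exact Complex.contDiff_exp.comp h1

/-- The trivial bound `‖ĝ_k(h)‖ ≤ sup ‖g‖` (any `g`). [folklore] -/
theorem norm_sliceFourierCoeff_le {B : ℝ} (hB : ∀ z, ‖g z‖ ≤ B) (k : ℤ) (h : ℝ) :
    ‖sliceFourierCoeff g k h‖ ≤ B := by
  have := intervalIntegral.norm_integral_le_of_norm_le_const (a := (0 : ℝ)) (b := 1) (C := B)
    (f := fun θ : ℝ => g (θ + h * I) * Complex.exp (-(2 * π * I * k * θ))) (fun θ _ => by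
      rw [norm_mul, norm_cexp_neg_two_pi, mul_one]; exact hB _)
  simpa [sliceFourierCoeff] using this

/-- **Bridge to Mathlib**: `ĝ_k(h)` is Mathlib's `fourierCoeffOn` of the slice on `[0, 1]`.
[folklore] -/
theorem sliceFourierCoeff_eq_fourierCoeffOn (g : ℂ → ℂ) (k : ℤ) (h : ℝ) :
    sliceFourierCoeff g k h = fourierCoeffOn zero_lt_one (fun θ : ℝ => g (θ + h * I)) k := by
  rw [fourierCoeffOn_eq_integral]
  simp only [sub_zero, div_one, one_smul, smul_eq_mul, fourier_coe_apply]
  unfold sliceFourierCoeff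
  refine intervalIntegral.integral_congr fun θ _ => ?_
  simp only [Complex.ofReal_one, div_one, Int.cast_neg]
  rw [mul_comm]
  congr 1
  ring_nf

namespace IsStripFun

/-- `ĝ_k(h) = 0` for `h ≤ 1/2`. [folklore] -/
theorem sliceFourierCoeff_eq_zero_of_le (hg : IsStripFun Y₁ g) {h : ℝ} (hh : h ≤ 1 / 2) (k : ℤ) : sliceFourierCoeff g k h = 0 := by
  unfold sliceFourierCoeff
  have : ∀ θ : ℝ, g (θ + h * I) * Complex.exp (-(2 * π * I * k * θ)) = 0 := fun θ => by
    rw [hg.zero_of_im_le (by simpa using hh), zero_mul]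
  simp [this]

/-- `ĝ_k(h) = 0` for `h > Y₁` (`HorocycleStripFourier.coeff_eq_zero_of_not_mem`). [folklore] -/
theorem sliceFourierCoeff_eq_zero_of_lt (hg : IsStripFun Y₁ g) {h : ℝ} (hh : Y₁ < h) (k : ℤ) : sliceFourierCoeff g k h = 0 :=
  HorocycleStripFourier.coeff_eq_zero_of_not_mem hg.supp (Or.inr hh) k

/-- **Integration by parts in `θ`**: `ĝ_k(h) = (∂θ g)^_k(h) / (2πik)` for `k ≠ 0`
(`HorocycleStripFourier.coeff_eq_coeff_fderiv`). [folklore] -/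
theorem sliceFourierCoeff_eq_derivTheta (hg : IsStripFun Y₁ g) {k : ℤ} (hk : k ≠ 0) (h : ℝ) :
    sliceFourierCoeff g k h = (1 / (2 * π * I * k)) * sliceFourierCoeff (derivTheta g) k h :=
  HorocycleStripFourier.coeff_eq_coeff_fderiv hg.contDiff hg.periodic h hk

/-- **Decay of the Fourier coefficients**: `‖ĝ_k(h)‖ ≤ B / |k|³` for `k ≠ 0`, uniformly in `h`
(`HorocycleStripFourier.exists_norm_coeff_le`). [folklore] -/
theorem sliceFourierCoeff_decay (hg : IsStripFun Y₁ g) :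
    ∃ B : ℝ, 0 ≤ B ∧ ∀ k : ℤ, k ≠ 0 → ∀ h : ℝ, ‖sliceFourierCoeff g k h‖ ≤ B / |(k : ℝ)| ^ 3 := by
  obtain ⟨B, hB0, hB⟩ := HorocycleStripFourier.exists_norm_coeff_le hg.contDiff hg.periodic hg.supp
  exact ⟨B, hB0, fun k hk h => hB h k hk⟩

/-! ### Regularity of `ĝ_k` in the height -/

/-- `h ↦ ĝ_k(h)` is `C^∞` on `ℝ` (a parametric integral of the smooth plane function
`(θ, h) ↦ g(θ + ih) e(-kθ)`; `Literature.Analysis.FunctionSpaces.contDiff_parametric_intervalIntegral`).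
[folklore] -/
theorem contDiff_sliceFourierCoeff (hg : IsStripFun Y₁ g) (k : ℤ) : ContDiff ℝ (⊤ : ℕ∞) (sliceFourierCoeff g k) := by
  have hH : ContDiff ℝ (⊤ : ℕ∞)
      (fun p : ℝ × ℝ => g ((p.1 : ℂ) + (p.2 : ℂ) * I) * Complex.exp (-(2 * π * I * k * p.1))) :=
    hg.contDiff_plane.mul ((contDiff_cexp_neg_two_pi k).comp contDiff_fst)
  exact Literature.Analysis.FunctionSpaces.contDiff_parametric_intervalIntegral (P := ℝ) hH 0 1

/-- `h ↦ ĝ_k(h)` is continuous. [folklore] -/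
theorem continuous_sliceFourierCoeff (hg : IsStripFun Y₁ g) (k : ℤ) : Continuous (sliceFourierCoeff g k) :=
  (hg.contDiff_sliceFourierCoeff k).continuous

/-- **Differentiation under the integral sign**: `ĝ_k'(h) = (∂h g)^_k(h)`
(`HorocycleStripFourier.hasDerivAt_coeff`). [folklore] -/
theorem hasDerivAt_sliceFourierCoeff (hg : IsStripFun Y₁ g) (k : ℤ) (h₀ : ℝ) :
    HasDerivAt (sliceFourierCoeff g k) (sliceFourierCoeff (derivH g) k h₀) h₀ :=
  HorocycleStripFourier.hasDerivAt_coeff hg.contDiff hg.periodic hg.supp k h₀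

/-- `deriv ĝ_k = (∂h g)^_k`. [folklore] -/
theorem deriv_sliceFourierCoeff (hg : IsStripFun Y₁ g) (k : ℤ) (h : ℝ) :
    deriv (sliceFourierCoeff g k) h = sliceFourierCoeff (derivH g) k h :=
  (hg.hasDerivAt_sliceFourierCoeff k h).deriv

/-! ### The Fourier series of a slice -/

/-- `∑_{k ∈ ℤ} 1/|k|³ < ∞`. [folklore] -/
theorem summable_one_div_abs_int_cube : Summable fun k : ℤ => 1 / |(k : ℝ)| ^ 3 := by
  have := ((Real.summable_one_div_int_pow (p := 3)).mpr (by norm_num)).abs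
  refine this.congr fun k => ?_
  rw [abs_div, abs_one, abs_pow]

/-- A summable majorant of the Fourier coefficients, uniform in the height:
`‖ĝ_k(h)‖ ≤ β_k` with `∑ β_k < ∞` (`β_k = B/|k|³` for `k ≠ 0`, `β₀ = sup ‖g‖`). [folklore] -/
theorem exists_summable_bound (hg : IsStripFun Y₁ g) :
    ∃ β : ℤ → ℝ, Summable β ∧ ∀ (k : ℤ) (h : ℝ), ‖sliceFourierCoeff g k h‖ ≤ β k := by
  obtain ⟨B, hB0, hB⟩ := hg.sliceFourierCoeff_decay
  obtain ⟨B₀, hB₀0, hB₀⟩ := hg.exists_bound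
  refine ⟨fun k => B * (1 / |(k : ℝ)| ^ 3) + (if k = 0 then B₀ else 0), ?_, fun k h => ?_⟩
  · refine (summable_one_div_abs_int_cube.mul_left B).add ?_
    exact summable_of_ne_finset_zero (s := {0}) (by intro k hk; simp at hk; simp [hk])
  · dsimp only
    split_ifs with hk
    · subst hk
      have := norm_sliceFourierCoeff_le hB₀ 0 h
      have h2 : 0 ≤ B * (1 / |((0 : ℤ) : ℝ)| ^ 3) := by simp
      linarith
    · rw [mul_one_div, add_zero]; exact hB k hk h

/-- Summability of the Fourier coefficients of a slice. [folklore] -/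
theorem summable_norm_sliceFourierCoeff (hg : IsStripFun Y₁ g) (h : ℝ) : Summable fun k : ℤ => ‖sliceFourierCoeff g k h‖ := by
  obtain ⟨β, hβ, hle⟩ := hg.exists_summable_bound
  exact Summable.of_nonneg_of_le (fun _ => norm_nonneg _) (fun k => hle k h) hβ

/-- Summability of the Fourier series coefficients themselves. [folklore] -/
theorem summable_sliceFourierCoeff (hg : IsStripFun Y₁ g) (h : ℝ) : Summable fun k : ℤ => sliceFourierCoeff g k h :=
  (hg.summable_norm_sliceFourierCoeff h).of_norm

/-- **Fourier expansion of a slice**: `g(θ + ih) = ∑_k ĝ_k(h) e(kθ)` for every `θ`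
(`HorocycleStripFourier.hasSum_fourier_of_periodic` applied to the slice). [folklore] -/
theorem hasSum_slice (hg : IsStripFun Y₁ g) (h θ : ℝ) :
    HasSum (fun k : ℤ => sliceFourierCoeff g k h * Complex.exp (2 * π * I * k * θ)) (g (θ + h * I)) := by
  have hp : ∀ x : ℝ, g ((x + 1 : ℝ) + h * I) = g (x + h * I) := fun x => by
    have := hg.periodic (x + h * I)
    rw [← this]; congr 1; push_cast; ring
  exact HorocycleStripFourier.hasSum_fourier_of_periodic (Φ := fun θ : ℝ => g (θ + h * I))
    (hg.continuous_slice h) hp (hg.summable_sliceFourierCoeff h) θ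

end IsStripFun

end Literature.NumberTheory.LFunctions

end
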